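import Mathlib.Tactic.Linarith
import Literature.AnabelianGeometry.SemiGraphs.PSCCoveringBranchData
import Literature.AnabelianGeometry.SemiGraphs.PSCCoveringDatumTransport
import Literature.AnabelianGeometry.SemiGraphs.PSCCoveringDatumSturdy
import HarnessLib

/-!
# The loop-faithful covering datum `restrictBD`: counts, Def. 1.4 transfers, sturdiness (proofs)

PROOF-ONLY companion of `PSCCoveringBranchData.lean` ([CombGC] Def. 1.1 (ii), Rmk. 1.1.5, Def. 1.4;
author's ms pp. 6, 8, 10–11 [cite: MochizukiCombGC2007, Def 1.1(ii) p.6]).  For the covering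
datum `G.restrictBD U hU bd` built from branch data `bd` (the repair of `restrict` after finding
F-L5t6g4-1: loops unfold according to `bd`):

* everything count-, subgroup- and filtration-level proved for `restrict`
  (`PSCCoveringDatumProofs`, `PSCCoveringDatumTransport`) holds VERBATIM for `restrictBD bd` — the
  two data agree except on `nodeEnds`/`genus`: `restrictBD_cuspCount_subgroupOf` (sub-covering
  counts), `isVerticial_restrictBD_iff'`, the six Def. 1.4 transfers `….restrictBD`;
* the Riemann–Hurwitz / sturdiness results are RE-PROVED for arbitrary branch data (their proofs
  only use the two inclusion laws): `branchCount_restrictBD_le` (`b_w ≤ d_w · b_v`),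
  `genus_le_restrictBD_genus`, **`IsSturdy.restrictBD`** (coverings of sturdy data are sturdy, now
  for the loop-faithful datum), `isNoncuspidal_restrictBD_iff`.

No new definitions; no statement here takes a side on [IUTchIII] Cor. 3.12.
-/

namespace Literature.AnabelianGeometry.SemiGraphs

open scoped Pointwise

universe u

namespace PSCDatum

open PSCCovering

variable {P : Type u} [Group P] [TopologicalSpace P] [IsTopologicalGroup P]
  {P' : Type u} [Group P'] [TopologicalSpace P'] [IsTopologicalGroup P']
  (G : PSCDatum P) (H : PSCDatum P') (α : P ≃ₜ* P')
  (U : Subgroup P) [U.FiniteIndex] (hU : IsOpen (U : Set P))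
  (U' : Subgroup P') [U'.FiniteIndex] (hU' : IsOpen (U' : Set P'))
  (h : U.map α.toMulEquiv.toMonoidHom = U') (bd : G.BranchData) (bd' : H.BranchData)

/-! ### Counts and subgroups (verbatim from `restrict`) -/

/-- Sub-covering cusp counts for `restrictBD`: `r` of the covering of `G_U` attached to `V ⊆ U`
is `G.cuspCount V`. [cite: MochizukiCombGC2007, Def 1.1(ii) p.6] -/
theorem restrictBD_cuspCount_subgroupOf (V : Subgroup P) (hV : V ≤ U) [V.FiniteIndex] :
    (G.restrictBD U hU bd).cuspCount (V.subgroupOf U) = G.cuspCount V :=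
  G.restrict_cuspCount U hU V hV

/-- Sub-covering node counts for `restrictBD`. [cite: MochizukiCombGC2007, Def 1.1(ii) p.6] -/
theorem restrictBD_nodeCount_subgroupOf (V : Subgroup P) (hV : V ≤ U) [V.FiniteIndex] :
    (G.restrictBD U hU bd).nodeCount (V.subgroupOf U) = G.nodeCount V :=
  G.restrict_nodeCount U hU V hV

/-- Sub-covering vertex counts for `restrictBD`. [cite: MochizukiCombGC2007, Def 1.1(ii) p.6] -/
theorem restrictBD_vertCount_subgroupOf (V : Subgroup P) (hV : V ≤ U) [V.FiniteIndex] :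
    (G.restrictBD U hU bd).vertCount (V.subgroupOf U) = G.vertCount V :=
  G.restrict_vertCount U hU V hV

variable {G U} in
/-- Verticial subgroups of `Π_{G_U}` (any branch data) are the traces of those of `Π_G`.
[cite: MochizukiCombGC2007, Def 1.1(ii) p.6] -/
theorem isVerticial_restrictBD_iff' (A : Subgroup U) :
    (G.restrictBD U hU bd).IsVerticial A ↔ ∃ B, G.IsVerticial B ∧ A = B.subgroupOf U :=
  isVerticial_restrict_iff hU A

variable {G U} in
/-- Edge-like subgroups of `Π_{G_U}` (any branch data) are the traces of those of `Π_G`.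
[cite: MochizukiCombGC2007, Def 1.1(ii) pp.6-7] -/
theorem isEdgeLike_restrictBD_iff' (A : Subgroup U) :
    (G.restrictBD U hU bd).IsEdgeLike A ↔ ∃ B, G.IsEdgeLike B ∧ A = B.subgroupOf U :=
  isEdgeLike_restrict_iff hU A

variable {G U} in
/-- Cuspidal subgroups of `Π_{G_U}` (any branch data) are the traces of those of `Π_G`.
[cite: MochizukiCombGC2007, Def 1.1(ii) p.7] -/
theorem isCuspidal_restrictBD_iff' (A : Subgroup U) :
    (G.restrictBD U hU bd).IsCuspidal A ↔ ∃ B, G.IsCuspidal B ∧ A = B.subgroupOf U :=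
  isCuspidal_restrict_iff hU A

/-- `M^vert` of a sub-covering computed in `restrictBD bd` is the one computed in `G`.
[cite: MochizukiCombGC2007, Def 1.1(ii) p.7] -/
theorem map_subtype_vertFil_restrictBD (V : Subgroup U) :
    ((G.restrictBD U hU bd).vertFil V).map U.subtype = G.vertFil (V.map U.subtype) :=
  G.map_subtype_vertFil hU V

/-! ### Def. 1.4 transfers for coverings corresponding via `α` (any branch data on both sides) -/

variable {U U'}

/-- Def. 1.4 (iv), cuspidal, for `restrictBD`. [cite: MochizukiCombGC2007, Def 1.4(iv) p.11] -/
theorem IsGroupTheoreticallyCuspidal.restrictBD (hα : G.IsGroupTheoreticallyCuspidal H α) :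
    (G.restrictBD U hU bd).IsGroupTheoreticallyCuspidal (H.restrictBD U' hU' bd') (restrictIso α h) :=
  hα.restrict G H α hU hU' h

/-- Def. 1.4 (iv), verticial, for `restrictBD`. [cite: MochizukiCombGC2007, Def 1.4(iv) p.11] -/
theorem IsGroupTheoreticallyVerticial.restrictBD (hα : G.IsGroupTheoreticallyVerticial H α) :
    (G.restrictBD U hU bd).IsGroupTheoreticallyVerticial (H.restrictBD U' hU' bd') (restrictIso α h) :=
  hα.restrict G H α hU hU' h

/-- Def. 1.4 (iv), edge-like, for `restrictBD`. [cite: MochizukiCombGC2007, Def 1.4(iv) p.11] -/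
theorem IsGroupTheoreticallyEdgeLike.restrictBD (hα : G.IsGroupTheoreticallyEdgeLike H α) :
    (G.restrictBD U hU bd).IsGroupTheoreticallyEdgeLike (H.restrictBD U' hU' bd') (restrictIso α h) :=
  hα.restrict G H α hU hU' h

/-- Def. 1.4 (ii) for `restrictBD` (profinite `Π`). [cite: MochizukiCombGC2007, Def 1.4(ii) p.10] -/
theorem IsNumericallyCuspidal.restrictBD [CompactSpace P] [CompactSpace P']
    (hα : G.IsNumericallyCuspidal H α) :
    (G.restrictBD U hU bd).IsNumericallyCuspidal (H.restrictBD U' hU' bd') (restrictIso α h) :=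
  hα.restrict G H α hU hU' h

/-- Def. 1.4 (iii), verticial, for `restrictBD`. [cite: MochizukiCombGC2007, Def 1.4(iii) p.10] -/
theorem IsVerticiallyFiltrationPreserving.restrictBD (hα : G.IsVerticiallyFiltrationPreserving H α) :
    (G.restrictBD U hU bd).IsVerticiallyFiltrationPreserving (H.restrictBD U' hU' bd')
      (restrictIso α h) :=
  hα.restrict G H α hU hU' h

/-- Def. 1.4 (iii), edge-wise, for `restrictBD`. [cite: MochizukiCombGC2007, Def 1.4(iii) p.10] -/
theorem IsEdgewiseFiltrationPreserving.restrictBD (hα : G.IsEdgewiseFiltrationPreserving H α) :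
    (G.restrictBD U hU bd).IsEdgewiseFiltrationPreserving (H.restrictBD U' hU' bd')
      (restrictIso α h) :=
  hα.restrict G H α hU hU' h

/-- Def. 1.4 (iii), graphically, for `restrictBD`. [cite: MochizukiCombGC2007, Def 1.4(iii) p.10] -/
theorem IsGraphicallyFiltrationPreserving.restrictBD (hα : G.IsGraphicallyFiltrationPreserving H α) :
    (G.restrictBD U hU bd).IsGraphicallyFiltrationPreserving (H.restrictBD U' hU' bd')
      (restrictIso α h) :=
  hα.restrict G H α hU hU' h

/-! ### Riemann–Hurwitz and sturdiness for arbitrary branch data -/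

variable (U)

omit [IsTopologicalGroup P] in
/-- **`b_w ≤ d_w · b_v`** for the graph built from any branch data. [cite: MochizukiCombGC2007, Def 1.1(ii) p.6] -/
theorem branchCount_restrictBD_le (w : (G.restrictGraphBD U bd).V) :
    (G.restrictGraphBD U bd).branchCount w ≤ G.localDegree U w * G.graph.branchCount w.1 := by
  classical
  obtain ⟨v, j⟩ := w
  rw [(G.restrictGraphBD U bd).branchCount_eq_of_nodeEnds
      (fun d => G.vertexOver U (bd.fst d.1) (G.nrep U d * (ConjAct.ofConjAct (bd.conjFst d.1))⁻¹))
      (fun d => G.vertexOver U (bd.snd d.1) (G.nrep U d * (ConjAct.ofConjAct (bd.conjSnd d.1))⁻¹))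
      (fun d => rfl),
    G.graph.branchCount_eq_of_nodeEnds bd.fst bd.snd bd.nodeEnds_eq, mul_add,
    Finset.card_filter, Finset.card_filter, Finset.mul_sum, Finset.mul_sum]
  set d := G.localDegree U ⟨v, j⟩ with hd
  have key : ∀ (K : Subgroup P) (v' : G.graph.V) (g : P),
      (∑ i : dcFin U K, if G.vertexOver U v' (dcRep U K i * g⁻¹) = ⟨v, j⟩ then 1 else 0) ≤
        d * (if v' = v then 1 else 0) := by
    intro K v' g
    by_cases hv : v' = v
    · subst hv
      rw [if_pos rfl, mul_one, ← Finset.card_filter]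
      have e : (Finset.univ.filter fun i : dcFin U K =>
          G.vertexOver U v' (dcRep U K i * g⁻¹) = ⟨v', j⟩) =
          Finset.univ.filter fun i : dcFin U K => dcIdx U (G.vertGp v') (dcRep U K i * g⁻¹) = j := by
        ext i
        simp [vertexOver]
      rw [e]
      exact card_filter_dcIdx_le U K (G.vertGp v') g j
    · rw [if_neg hv, mul_zero]
      refine le_of_eq (Finset.sum_eq_zero fun i _ => if_neg fun h => hv ?_)
      exact congrArg Sigma.fst h
  refine add_le_add ?_ ?_
  · refine le_trans (le_of_eq (Fintype.sum_sigma _)) (Finset.sum_le_sum fun c _ => ?_)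
    exact key (G.cuspGp c) (G.graph.cuspEnd c) (ConjAct.ofConjAct (G.cuspConj c))
  · refine le_trans (le_of_eq (Fintype.sum_sigma _)) (Finset.sum_le_sum fun e _ => ?_)
    rw [Finset.sum_add_distrib, mul_add]
    exact add_le_add (key (G.nodeGp e) (bd.fst e) (ConjAct.ofConjAct (bd.conjFst e)))
      (key (G.nodeGp e) (bd.snd e) (ConjAct.ofConjAct (bd.conjSnd e)))

/-- **`g_w ≥ g_v` for `g_v ≥ 1`** (Riemann–Hurwitz), any branch data. [cite: MochizukiCombGC2007, Rmk 1.1.5 p.8] -/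
theorem genus_le_restrictBD_genus (w : (G.restrictGraphBD U bd).V) (hg : 1 ≤ G.genus w.1) :
    G.genus w.1 ≤ (G.restrictBD U hU bd).genus w := by
  have hb := G.branchCount_restrictBD_le U bd w
  have hd := G.localDegree_pos U w
  rw [restrictBD_genus]
  unfold hurwitzGenus
  set d := G.localDegree U w
  set gv := G.genus w.1
  set bv := G.graph.branchCount w.1
  set bw := (G.restrictGraphBD U bd).branchCount w
  have hb' : (bw : ℤ) ≤ (d : ℤ) * bv := by exact_mod_cast hb
  have hX : 2 * (gv : ℤ) - 2 ≤ (d : ℤ) * (2 * (gv : ℤ) - 2 + bv) - bw := by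
    have hd' : (1 : ℤ) ≤ d := by exact_mod_cast hd
    have hg' : (1 : ℤ) ≤ gv := by exact_mod_cast hg
    nlinarith
  omega

/-- **Coverings of sturdy data are sturdy**, for the loop-faithful datum with ANY branch data.
[cite: MochizukiCombGC2007, Rmk 1.1.5 p.8] -/
theorem IsSturdy.restrictBD (hs : G.IsSturdy) : (G.restrictBD U hU bd).IsSturdy := fun w =>
  (hs w.1).trans (G.genus_le_restrictBD_genus U hU bd w (le_trans (by norm_num) (hs w.1)))

/-- `G_U` (any branch data) is noncuspidal iff `G` is. [cite: MochizukiCombGC2007, Def 1.1(i)-(ii) p.6] -/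
theorem isNoncuspidal_restrictBD_iff :
    (G.restrictBD U hU bd).graph.IsNoncuspidal ↔ G.graph.IsNoncuspidal :=
  G.isNoncuspidal_restrict_iff U hU

end PSCDatum

end Literature.AnabelianGeometry.SemiGraphs
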